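import Summits.CriticalPhenomena.PercolationContinuityZ3.Theorems.PercNearOneGluingNoHeavyLowerTailAntitheticPieces
import Summits.CriticalPhenomena.PercolationContinuityZ3.Theorems.PercNearOneGluingNoHeavyLowerTailAntitheticSealing
import HarnessLib

/-!
# `NoHeavyLowerTail` (stmt-CriticalPhenomena-4575) — antithetic cluster pairs: the LOBE-FLIP LEMMA behind the canonical abstract cubes
# (prim-hp-2 gen 50, MEMO-gen50 §2 (L2))

Support file (`--supports stmt-CriticalPhenomena-4575`, hull-port prover `prim-hp-2`, gen 50).  No definitions, no named facts, no sorries;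
standard axioms.

Setting (MEMO-gen31/49/50): colouring `x ⊆ Sym2 V` of the edge set `E` (`x` red, `xᶜ` blue), source `s`, RED vertex cluster
`J = openCluster (x ∩ E) s`, BLUE vertex cluster `U = openCluster (xᶜ ∩ E) s`.  A BLUE LOBE is a component of the graph `G[U ∖ J]` (blue-only
vertices, edges of `E`); here we only use that a vertex set `S ⊆ U ∖ J` is CLOSED — no `E`-edge joins `S` to a vertex of `U ∖ J` outside `S` —
i.e. `S` is a union of blue lobes.  Flipping `S` means complementing `x` on every edge of `E` that meets `S`:
`y_S = x ∆ {e ∈ E : e ∩ S ≠ ∅}`.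

LOBE-FLIP LEMMA (MEMO-gen50 §2, the content of the CANONICAL CUBES LEMMA (L2); generalises 'flip the blue lobe' of MEMO-gen47 §3d and the
lobe cubes of THEOREM D to arbitrary cores):
* `Antithetic.lobeflip_red_eq` — the red cluster of `y_S` is EXACTLY `J ∪ S`;
* `Antithetic.lobeflip_blue_subset` — the blue cluster of `y_S'` is contained in the blue cluster of `y_S` for closed `S ⊆ S'`, and misses `S'`
  (antitone in `S`; with `S = ∅`: contained in `U`);
* `Antithetic.lobeflip_core_subset` — every vertex in both clusters of `y_S` is in both clusters of `x` (so `y_S ∈ D(R)` whenever `x ∈ D(R)`).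
* `Antithetic.lobecube_sum_nonneg` — the CANONICAL CUBE THEOREM: the half-flip family over any up-set `High` with `T ∈ High ↔ Tᶜ ∉ High` is an
  abstract cube (cf. `Antithetic.cube_sum_nonneg`), hence has nonnegative antithetic sum.
No nestedness or 'no-demotion' hypothesis is needed.  Consequently (MEMO-gen50 §2), for the blue lobes `M₁,…,M_k` of any `x` and any
self-dual-free up-set `High ⊂ 2^[k]`, the slots `σ ↦ y_{M_σ}` (`σ ∈ High`), `σ ↦ (y_{M_σ̄})ᶜ` (`σ ∉ High`) form an abstract cube in the sense of
`Antithetic.cube_sum_nonneg` (red clusters monotone by `lobeflip_red_eq` / `lobeflip_blue_subset`, opposite slots complementary by construction).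
[cite: VandenbergHaggstromKahn2005, §1 p. 3 (open cluster `C_s`)]
-/

noncomputable section

namespace Summit.CriticalPhenomena.PercolationContinuityZ3.Theorems

open Literature.Probability.Percolation
open scoped Classical symmDiff

namespace Antithetic

section LobeFlip

variable {V : Type*}

/-- **Lobe-flip lemma, red side** (MEMO-gen50 §2 (L2)(b)).  Let `J`/`U` be the red/blue vertex clusters of `s` in the colouring `x` of `E`, and
`S ⊆ U ∖ J` a CLOSED set of blue-only vertices (no `E`-edge from `S` to a vertex of `U ∖ J` outside `S`).  Then the red cluster of
`y_S = x ∆ {e ∈ E : e meets S}` is exactly `J ∪ S`: the old red paths inside `J` are untouched, every vertex of `S` is reached through the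
flipped tail of a blue path (which runs inside `S` after its last visit to `J`), and `J ∪ S` is sealed against the new red edges. [this work] -/
theorem lobeflip_red_eq (E x : Set (Sym2 V)) (s : V) (S : Set V)
    (hSU : S ⊆ openCluster (xᶜ ∩ E) s) (hSJ : Disjoint S (openCluster (x ∩ E) s))
    (hcl : ∀ a b, s(a, b) ∈ E → a ∈ S → b ∈ openCluster (xᶜ ∩ E) s → b ∉ openCluster (x ∩ E) s → b ∈ S) :
    openCluster ((x ∆ {e | e ∈ E ∧ ∃ v ∈ e, v ∈ S}) ∩ E) s = openCluster (x ∩ E) s ∪ S := by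
  set J := openCluster (x ∩ E) s with hJ
  set U := openCluster (xᶜ ∩ E) s with hU
  set Fl := {e | e ∈ E ∧ ∃ v ∈ e, v ∈ S} with hFl
  set y := x ∆ Fl with hy
  have hsJ : s ∈ J := mem_openCluster_self _ _
  have hsS : s ∉ S := fun h => Set.disjoint_left.1 hSJ h hsJ
  -- an edge with no endpoint in S keeps its colour
  have unflip : ∀ {a b : V}, a ∉ S → b ∉ S → (s(a, b) ∈ y ↔ s(a, b) ∈ x) := by
    intro a b ha hb
    have hnot : s(a, b) ∉ Fl := by
      rintro ⟨_, v, hv, hvS⟩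
      rcases Sym2.mem_iff.1 hv with rfl | rfl
      · exact ha hvS
      · exact hb hvS
    rw [hy, Set.mem_symmDiff]
    constructor
    · rintro (⟨h, _⟩ | ⟨h, _⟩)
      · exact h
      · exact absurd h hnot
    · exact fun h => Or.inl ⟨h, hnot⟩
  -- an edge of E meeting S has its colour complemented
  have flip : ∀ {a b : V}, s(a, b) ∈ E → (a ∈ S ∨ b ∈ S) → (s(a, b) ∈ y ↔ s(a, b) ∉ x) := by
    intro a b hE hab
    have hmem : s(a, b) ∈ Fl := by
      rcases hab with h | h
      · exact ⟨hE, a, Sym2.mem_mk_left a b, h⟩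
      · exact ⟨hE, b, Sym2.mem_mk_right a b, h⟩
    rw [hy, Set.mem_symmDiff]
    constructor
    · rintro (⟨_, h⟩ | ⟨_, h⟩)
      · exact absurd hmem h
      · exact h
    · exact fun h => Or.inr ⟨hmem, h⟩
  apply Set.Subset.antisymm
  · -- ⊆ : the complement of J ∪ S is sealed against y-red edges
    have hseal : ∀ a b, a ∉ (J ∪ S)ᶜ → b ∈ (J ∪ S)ᶜ → s(a, b) ∉ y ∩ E := by
      intro a b ha hb hab
      have ha' : a ∈ J ∪ S := not_not.1 ha
      have hbJ : b ∉ J := fun h => hb (Or.inl h)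
      have hbS : b ∉ S := fun h => hb (Or.inr h)
      have hne : a ≠ b := by rintro rfl; exact hb ha'
      rcases ha' with haJ | haS
      · -- a ∈ J, unflipped edge; red would put b in J
        have haS : a ∉ S := fun h => Set.disjoint_left.1 hSJ h haJ
        have hx : s(a, b) ∈ x := (unflip haS hbS).1 hab.1
        exact hbJ (haJ.trans ((openGraph_adj (x ∩ E) a b).2 ⟨⟨hx, hab.2⟩, hne⟩).reachable)
      · -- a ∈ S, flipped edge: y-red means x-blue; then b ∈ U, b ∉ J, so b ∈ S by closedness
        have hxb : s(a, b) ∉ x := (flip hab.2 (Or.inl haS)).1 hab.1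
        have hbU : b ∈ U := (hSU haS).trans ((openGraph_adj (xᶜ ∩ E) a b).2 ⟨⟨hxb, hab.2⟩, hne⟩).reachable
        exact hbS (hcl a b hab.2 haS hbU hbJ)
    intro v hv
    have hs : s ∉ (J ∪ S)ᶜ := fun h => h (Or.inl hsJ)
    exact not_not.1 (reachable_of_sealed (y ∩ E) (y ∩ E) s (J ∪ S)ᶜ hs (fun _ _ _ _ => Iff.rfl) hseal hv).2
  · -- ⊇
    -- (1) J: red x-walks from s stay inside J and are untouched
    have hJsub : J ⊆ openCluster (y ∩ E) s := by
      have hw : ∀ {a v : V} (_ : (openGraph (x ∩ E)).Walk a v), a ∈ J → (openGraph (y ∩ E)).Reachable s a →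
          (openGraph (y ∩ E)).Reachable s v := by
        intro a v p
        induction p with
        | nil => exact fun _ h => h
        | @cons a b c hab _ ih =>
          intro haJ hsa
          rw [openGraph_adj] at hab
          have hbJ : b ∈ J := haJ.trans ((openGraph_adj _ a b).2 hab).reachable
          have haS : a ∉ S := fun h => Set.disjoint_left.1 hSJ h haJ
          have hbS : b ∉ S := fun h => Set.disjoint_left.1 hSJ h hbJ
          have hyab : s(a, b) ∈ y ∩ E := ⟨(unflip haS hbS).2 hab.1.1, hab.1.2⟩
          exact ih hbJ (hsa.trans ((openGraph_adj _ a b).2 ⟨hyab, hab.2⟩).reachable)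
      intro v hv
      obtain ⟨p⟩ := hv
      exact hw p hsJ (SimpleGraph.Reachable.refl s)
    -- (2) S: induct on a blue x-walk from the vertex back to s
    have hSsub : ∀ {b c : V} (_ : (openGraph (xᶜ ∩ E)).Walk b c), c = s → b ∈ S → (openGraph (y ∩ E)).Reachable s b := by
      intro b c q
      induction q with
      | nil => intro hc hb; exact absurd (hc ▸ hb) hsS
      | @cons b b' c hbb' q' ih =>
        intro hc hbS
        rw [openGraph_adj] at hbb'
        have hE : s(b, b') ∈ E := hbb'.1.2
        have hE' : s(b', b) ∈ E := by rw [Sym2.eq_swap]; exact hE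
        have hyedge : s(b', b) ∈ y ∩ E := by
          refine ⟨(flip hE' (Or.inr hbS)).2 ?_, hE'⟩
          rw [Sym2.eq_swap]; exact hbb'.1.1
        have hadj : (openGraph (y ∩ E)).Adj b' b := (openGraph_adj _ b' b).2 ⟨hyedge, hbb'.2.symm⟩
        by_cases hb'J : b' ∈ J
        · exact (hJsub hb'J).trans hadj.reachable
        · have hb'U : b' ∈ U := by
            have : (openGraph (xᶜ ∩ E)).Reachable b' c := ⟨q'⟩
            rw [hc] at this
            exact this.symm
          have hb'S : b' ∈ S := hcl b b' hE hbS hb'U hb'J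
          exact (ih hc hb'S).trans hadj.reachable
    intro v hv
    rcases hv with hv | hv
    · exact hJsub hv
    · obtain ⟨p⟩ := (hSU hv : (openGraph (xᶜ ∩ E)).Reachable s v)
      exact hSsub p.reverse rfl hv

/-- **Lobe-flip lemma, blue side** (MEMO-gen50 §2 (L2)(c)).  For closed sets `S ⊆ S'` of blue-only vertices, the blue cluster of `y_{S'}` is
contained in the blue cluster of `y_S` and misses `S'` (taking `S = ∅`: it is contained in `U` and misses `S'`): a blue path of `y_{S'}` from `s`
can never enter `S'` (an edge into `S'` from outside is either a red attachment from `J` — impossible, `J` is the whole red cluster — or joins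
`S'` to another blue-only vertex, excluded by closedness), so it uses only unflipped edges. [this work] -/
theorem lobeflip_blue_subset (E x : Set (Sym2 V)) (s : V) (S S' : Set V) (hSS' : S ⊆ S')
    (hS'J : Disjoint S' (openCluster (x ∩ E) s))
    (hcl' : ∀ a b, s(a, b) ∈ E → a ∈ S' → b ∈ openCluster (xᶜ ∩ E) s → b ∉ openCluster (x ∩ E) s → b ∈ S') :
    openCluster ((x ∆ {e | e ∈ E ∧ ∃ v ∈ e, v ∈ S'})ᶜ ∩ E) s ⊆
      openCluster ((x ∆ {e | e ∈ E ∧ ∃ v ∈ e, v ∈ S})ᶜ ∩ E) s \ S' := by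
  set J := openCluster (x ∩ E) s with hJ
  set U := openCluster (xᶜ ∩ E) s with hU
  set y := x ∆ {e | e ∈ E ∧ ∃ v ∈ e, v ∈ S} with hy
  set y' := x ∆ {e | e ∈ E ∧ ∃ v ∈ e, v ∈ S'} with hy'
  have hsJ : s ∈ J := mem_openCluster_self _ _
  have hsS' : s ∉ S' := fun h => Set.disjoint_left.1 hS'J h hsJ
  have unflip : ∀ (T : Set V) {a b : V}, a ∉ T → b ∉ T →
      (s(a, b) ∈ x ∆ {e | e ∈ E ∧ ∃ v ∈ e, v ∈ T} ↔ s(a, b) ∈ x) := by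
    intro T a b ha hb
    have hnot : s(a, b) ∉ {e | e ∈ E ∧ ∃ v ∈ e, v ∈ T} := by
      rintro ⟨_, v, hv, hvT⟩
      rcases Sym2.mem_iff.1 hv with rfl | rfl
      · exact ha hvT
      · exact hb hvT
    rw [Set.mem_symmDiff]
    constructor
    · rintro (⟨h, _⟩ | ⟨h, _⟩)
      · exact h
      · exact absurd h hnot
    · exact fun h => Or.inl ⟨h, hnot⟩
  -- walk induction: a y'-blue walk from s stays in U \ S' and is y-blue
  have hw : ∀ {a v : V} (_ : (openGraph (y'ᶜ ∩ E)).Walk a v), a ∈ U → a ∉ S' → (openGraph (yᶜ ∩ E)).Reachable s a →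
      (openGraph (yᶜ ∩ E)).Reachable s v ∧ v ∉ S' := by
    intro a v p
    induction p with
    | nil => exact fun _ ha h => ⟨h, ha⟩
    | @cons a b c hab _ ih =>
      intro haU haS' hsa
      rw [openGraph_adj] at hab
      obtain ⟨⟨hy'ab, hE⟩, hne⟩ := hab
      -- b ∉ S': otherwise the edge meets S', is flipped, hence x-red from a ∈ U \ S' into S'
      have hbS' : b ∉ S' := by
        intro hbS'
        have hfl : s(a, b) ∈ {e | e ∈ E ∧ ∃ v ∈ e, v ∈ S'} := ⟨hE, b, Sym2.mem_mk_right a b, hbS'⟩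
        have hxab : s(a, b) ∈ x := by
          by_contra hx
          exact hy'ab (by rw [hy', Set.mem_symmDiff]; exact Or.inr ⟨hfl, hx⟩)
        by_cases haJ : a ∈ J
        · -- red edge from the red cluster: b ∈ J, contradicting S' ∩ J = ∅
          have hbJ : b ∈ J := haJ.trans ((openGraph_adj (x ∩ E) a b).2 ⟨⟨hxab, hE⟩, hne⟩).reachable
          exact Set.disjoint_left.1 hS'J hbS' hbJ
        · -- a blue-only outside S', adjacent to S': closedness forces a ∈ S'
          have hE' : s(b, a) ∈ E := by rw [Sym2.eq_swap]; exact hE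
          exact haS' (hcl' b a hE' hbS' haU haJ)
      have hxab : s(a, b) ∉ x := fun hx => hy'ab ((unflip S' haS' hbS').2 hx)
      have hbU : b ∈ U := haU.trans ((openGraph_adj (xᶜ ∩ E) a b).2 ⟨⟨hxab, hE⟩, hne⟩).reachable
      have hyab : s(a, b) ∈ yᶜ ∩ E :=
        ⟨fun h => hxab ((unflip S (fun h' => haS' (hSS' h')) (fun h' => hbS' (hSS' h'))).1 h), hE⟩
      have hadj : (openGraph (yᶜ ∩ E)).Adj a b := (openGraph_adj _ a b).2 ⟨hyab, hne⟩
      exact ih hbU hbS' (hsa.trans hadj.reachable)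
  intro v hv
  obtain ⟨p⟩ := hv
  have := hw p (mem_openCluster_self _ _) hsS' (SimpleGraph.Reachable.refl s)
  exact ⟨this.1, this.2⟩

/-- **Lobe-flip lemma, core** (MEMO-gen50 §2 (L2)(a)): a vertex lying in both clusters of `y_S` lies in both clusters of `x`
(the red cluster of `y_S` is `J ∪ S`, the blue one misses `S` and is contained in `U`).  Hence flipping closed sets of blue-only vertices
never leaves the constraint set `D(R)`. [this work] -/
theorem lobeflip_core_subset (E x : Set (Sym2 V)) (s : V) (S : Set V)
    (hSU : S ⊆ openCluster (xᶜ ∩ E) s) (hSJ : Disjoint S (openCluster (x ∩ E) s))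
    (hcl : ∀ a b, s(a, b) ∈ E → a ∈ S → b ∈ openCluster (xᶜ ∩ E) s → b ∉ openCluster (x ∩ E) s → b ∈ S) :
    openCluster ((x ∆ {e | e ∈ E ∧ ∃ v ∈ e, v ∈ S}) ∩ E) s ∩ openCluster ((x ∆ {e | e ∈ E ∧ ∃ v ∈ e, v ∈ S})ᶜ ∩ E) s ⊆
      openCluster (x ∩ E) s ∩ openCluster (xᶜ ∩ E) s := by
  intro v hv
  have hred : v ∈ openCluster (x ∩ E) s ∪ S := by
    rw [← lobeflip_red_eq E x s S hSU hSJ hcl]; exact hv.1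
  have hblue := lobeflip_blue_subset E x s ∅ S (Set.empty_subset S) hSJ hcl hv.2
  have hvS : v ∉ S := hblue.2
  have hvJ : v ∈ openCluster (x ∩ E) s := hred.resolve_right hvS
  refine ⟨hvJ, ?_⟩
  -- the blue cluster of y_∅ = x ∆ ∅-flip is the blue cluster of x
  have h0 : {e : Sym2 V | e ∈ E ∧ ∃ v ∈ e, v ∈ (∅ : Set V)} = ∅ := by
    ext e; simp
  have hx0 : x ∆ (∅ : Set (Sym2 V)) = x := by
    rw [Set.symmDiff_def, Set.sdiff_empty, Set.empty_sdiff, Set.union_empty]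
  have := hblue.1
  rw [h0, hx0] at this
  exact this

end LobeFlip

section Cube

variable {V : Type*} {ι : Type*} [Fintype ι]

/-- **Canonical cube theorem** (MEMO-gen50 §2 (L2)): for ANY colouring `x` of `E`, closed sets `M i` of blue-only vertices (unions of blue lobes)
covering `U ∖ J`, and any up-set `High` of index sets with `T ∈ High ↔ Tᶜ ∉ High`, the slots `T ↦ y_{M_T}` (`T ∈ High`) and
`T ↦ (y_{M_{Tᶜ}})ᶜ` (`T ∉ High`), where `y_S = x ∆ {e ∈ E : e meets S}` and `M_T = ⋃_{i∈T} M i`, form an abstract cube, so the antithetic sum of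
`Δ_{F,G}` over its `2^|ι|` slots is nonnegative for increasing vertex functions `F, G` — with no nestedness, no-demotion or consistency
hypothesis.  (Rooted at the orbit of `y_{M_univ}` = 'all these lobes red'.) [this work] -/
theorem lobecube_sum_nonneg (E x : Set (Sym2 V)) (s : V) (M : ι → Set V)
    (hMU : ∀ i, M i ⊆ openCluster (xᶜ ∩ E) s) (hMJ : ∀ i, Disjoint (M i) (openCluster (x ∩ E) s))
    (hcl : ∀ i a b, s(a, b) ∈ E → a ∈ M i → b ∈ openCluster (xᶜ ∩ E) s → b ∉ openCluster (x ∩ E) s → b ∈ M i)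
    (hcov : openCluster (xᶜ ∩ E) s \ openCluster (x ∩ E) s ⊆ ⋃ i, M i)
    (High : Set (Set ι)) (hup : ∀ T T', T ∈ High → T ⊆ T' → T' ∈ High) (hsd : ∀ T, T ∈ High ↔ Tᶜ ∉ High)
    {F G : Set V → ℝ} (hF : Monotone F) (hG : Monotone G) :
    let y : Set V → Set (Sym2 V) := fun S => x ∆ {e | e ∈ E ∧ ∃ v ∈ e, v ∈ S}
    let β : Set ι → Set (Sym2 V) := fun T => if T ∈ High then y (⋃ i ∈ T, M i) else (y (⋃ i ∈ Tᶜ, M i))ᶜ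
    0 ≤ ∑ T : Set ι, (F (openCluster (β T ∩ E) s) - F (openCluster ((β T)ᶜ ∩ E) s)) *
      (G (openCluster (β T ∩ E) s) - G (openCluster ((β T)ᶜ ∩ E) s)) := by
  intro y β
  set J := openCluster (x ∩ E) s with hJ
  set U := openCluster (xᶜ ∩ E) s with hU
  -- every union M_T is a closed set of blue-only vertices
  have gU : ∀ T : Set ι, (⋃ i ∈ T, M i) ⊆ U := fun T =>
    Set.iUnion₂_subset fun i _ => hMU i
  have gJ : ∀ T : Set ι, Disjoint (⋃ i ∈ T, M i) J := fun T =>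
    Set.disjoint_left.2 fun v hv hvJ => by
      obtain ⟨i, -, hvi⟩ := Set.mem_iUnion₂.1 hv
      exact Set.disjoint_left.1 (hMJ i) hvi hvJ
  have gcl : ∀ T : Set ι, ∀ a b, s(a, b) ∈ E → a ∈ (⋃ i ∈ T, M i) → b ∈ U → b ∉ J → b ∈ (⋃ i ∈ T, M i) := by
    intro T a b hE ha hbU hbJ
    obtain ⟨i, hiT, hai⟩ := Set.mem_iUnion₂.1 ha
    exact Set.mem_iUnion₂.2 ⟨i, hiT, hcl i a b hE hai hbU hbJ⟩
  have red_eq : ∀ T : Set ι, openCluster (y (⋃ i ∈ T, M i) ∩ E) s = J ∪ ⋃ i ∈ T, M i := fun T =>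
    lobeflip_red_eq E x s _ (gU T) (gJ T) (gcl T)
  have blue_sub : ∀ T T' : Set ι, T ⊆ T' →
      openCluster ((y (⋃ i ∈ T', M i))ᶜ ∩ E) s ⊆ openCluster ((y (⋃ i ∈ T, M i))ᶜ ∩ E) s \ ⋃ i ∈ T', M i := fun T T' hTT' =>
    lobeflip_blue_subset E x s _ _ (Set.biUnion_subset_biUnion_left hTT') (gJ T') (gcl T')
  have blue_U : ∀ T : Set ι, openCluster ((y (⋃ i ∈ T, M i))ᶜ ∩ E) s ⊆ U \ ⋃ i ∈ T, M i := by
    intro T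
    have h := lobeflip_blue_subset E x s ∅ _ (Set.empty_subset _) (gJ T) (gcl T)
    have h0 : {e : Sym2 V | e ∈ E ∧ ∃ v ∈ e, v ∈ (∅ : Set V)} = ∅ := by ext e; simp
    have hx0 : x ∆ (∅ : Set (Sym2 V)) = x := by
      rw [Set.symmDiff_def, Set.sdiff_empty, Set.empty_sdiff, Set.union_empty]
    intro v hv
    have hv' := h hv
    refine ⟨?_, hv'.2⟩
    have := hv'.1
    rw [h0, hx0] at this
    exact this
  -- opposite slots are complementary colourings
  have hopp_set : ∀ T : Set ι, β Tᶜ = (β T)ᶜ := by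
    intro T
    by_cases hT : T ∈ High
    · have hTc : Tᶜ ∉ High := (hsd T).1 hT
      simp only [β, if_pos hT, if_neg hTc, compl_compl]
    · have hTc : Tᶜ ∈ High := (hsd Tᶜ).2 (by rw [compl_compl]; exact hT)
      simp only [β, if_neg hT, if_pos hTc, compl_compl]
  have hmono : Monotone fun T => openCluster (β T ∩ E) s := by
    intro T T' hTT'
    by_cases hT : T ∈ High
    · have hT' : T' ∈ High := hup T T' hT hTT'
      simp only [β, if_pos hT, if_pos hT', red_eq]
      exact Set.union_subset_union_right _ (Set.biUnion_subset_biUnion_left hTT')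
    · by_cases hT' : T' ∈ High
      · -- blue(y_{M_{Tᶜ}}) ⊆ U \ M_{Tᶜ} ⊆ J ∪ M_T ⊆ J ∪ M_{T'} = red(y_{M_{T'}})
        simp only [β, if_neg hT, if_pos hT', red_eq]
        intro v hv
        obtain ⟨hvU, hvM⟩ := blue_U Tᶜ hv
        by_cases hvJ : v ∈ J
        · exact Or.inl hvJ
        · obtain ⟨i, hvi⟩ := Set.mem_iUnion.1 (hcov ⟨hvU, hvJ⟩)
          have hiT : i ∈ T := by
            by_contra hi
            exact hvM (Set.mem_iUnion₂.2 ⟨i, hi, hvi⟩)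
          exact Or.inr (Set.mem_iUnion₂.2 ⟨i, hTT' hiT, hvi⟩)
      · -- both low: blue antitone
        simp only [β, if_neg hT, if_neg hT']
        exact fun v hv => (blue_sub T'ᶜ Tᶜ (Set.compl_subset_compl.2 hTT') hv).1
  have hopp : ∀ T : Set ι, openCluster (β Tᶜ ∩ E) s = openCluster ((β T)ᶜ ∩ E) s := fun T => by rw [hopp_set T]
  -- Harris on the cube (as in `Antithetic.cube_sum_nonneg` of …AntitheticAbstractCubes): Φ T := red cluster of the opposite slot.
  have hanti : Antitone fun T : Set ι => openCluster (β Tᶜ ∩ E) s := fun T T' h =>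
    hmono (Set.compl_subset_compl.2 h)
  have h := piece_abstract (fun T : Set ι => openCluster (β Tᶜ ∩ E) s) hanti hF hG
  refine h.trans_eq (Finset.sum_congr rfl fun T _ => ?_)
  simp only [compl_compl, hopp T]
  ring

end Cube

end Antithetic

end Summit.CriticalPhenomena.PercolationContinuityZ3.Theorems
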